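import Summits.Ventures.HodgeRepro2.T6A3IntegralModel

/-!
# T6-A3 — detection: the Weil coordinates of a class are its pairings (Lemma A5.6, basis form)

Tier 6 (README §10), sub-goal A3, seat t6-p3; proof lane (carrier-free, in p5's twelve-plane model).
TIER4 §A3 Lemma A5.6: for `v ∈ H⁴(B, ℂ)` and an embedding σ, `⟨v, θ⁸ ∪ w_σ⟩ = 8!·c_{I_σ}·vol·λ_{σ̄}(v)`,
where `λ_τ(v)` is the coefficient of the Weil monomial `w_τ` in `v`; consequently the Weil projection
`p_W(v) = Σ_τ λ_τ(v) w_τ` vanishes iff every pairing `⟨v, θ⁸ ∪ w_σ⟩` does.  p5's accepted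
`WeilDetect.integral_mono_mul_ET_mul_weil_eq_zero` / `integral_weil_conj_mul_ET_mul_weil` are the
monomial-by-monomial form; this file states the lemma for an ARBITRARY element `x` of the model
through the monomial basis `monoBasis` of `T6A3IntegralModel` (`x = Σ_t repr x t • e_t`):

* `integral_mul_ET_mul_weil`: `∫ (x ∧ E_{I_σ} ∧ w_σ) = ± vol · repr x (weilIdx P₀ σ̄)`,
* `integral_mul_theta_pow_mul_weil`: `∫ (x ∧ θ⁸ ∧ w_σ) = 8!·c_{I_σ}·(± vol)·repr x (weilIdx P₀ σ̄)`,
* `modelWeilProj`: the model Weil projector (the coordinates at a finite set `W` of index sets, kept;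
  the others killed) and `repr_eq_zero_of_weilProj_eq_zero`.
Nothing here is a display.
-/

namespace Summit.Ventures.HodgeRepro2.T6.A3Detect

open WeilPlanes WeilIntegral WeilDetect A3IntegralModel

variable {ι : Type*} [DecidableEq ι] [Fintype ι]

/-! ## 1. Monomials of the wrong length integrate to zero -/

/-- p5's integral kills every monomial whose generator list does not have exactly `N` entries
(`N` the number of generators): either a generator repeats or one is missing. -/
theorem integral_mono_eq_zero_of_length_ne (l : List (Gen ι)) (h : l.length ≠ Fintype.card (Gen ι)) :
    integral (mono l) = 0 := by
  apply integral_mono_eq_zero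
  by_cases hnd : l.Nodup
  · right
    by_contra hall
    have hall' : ∀ j, j ∈ l := fun j => by_contra fun hj => hall ⟨j, hj⟩
    apply h
    have : l.toFinset = Finset.univ := Finset.eq_univ_of_forall fun j => List.mem_toFinset.mpr (hall' j)
    rw [← List.toFinset_card_of_nodup hnd, this, Finset.card_univ]
  · exact Or.inl hnd

omit [Fintype ι] in
/-- `E_T ∧ w = ` the monomial of the concatenated generator lists. -/
theorem ET_mul_weil_eq_mono (T P₀ : Finset ι) (s : Bool) :
    ET T * weil P₀ s = mono (planeList T ++ weilList P₀ s) := by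
  rw [mono_append, ET_eq_mono]
  rfl

omit [DecidableEq ι] [Fintype ι] in
/-- `|planeList T| = 2 |T|`. -/
theorem length_planeList (T : Finset ι) : (planeList T).length = 2 * T.card := by
  unfold planeList
  rw [List.length_flatMap]
  simp [Finset.length_toList, mul_comm]

/-! ## 2. The index set of the Weil monomial and the single-monomial integrals -/

/-- The index set (in the enumeration of the generators) of the Weil monomial `w_{(P₀, s)}`. -/
noncomputable def weilIdx (P₀ : Finset ι) (s : Bool) : Finset (Fin (Fintype.card (Gen ι))) :=
  (weilList P₀ s).toFinset.image (genEnum ι)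

/-- `genEnum⁻¹ '' weilIdx P₀ s` is the set of generators of `w_{(P₀, s)}`. -/
theorem mem_weilIdx (P₀ : Finset ι) (s : Bool) (k : Fin (Fintype.card (Gen ι))) :
    k ∈ weilIdx P₀ s ↔ (genEnum ι).symm k ∈ weilList P₀ s := by
  unfold weilIdx
  rw [Finset.mem_image]
  constructor
  · rintro ⟨j, hj, rfl⟩
    rw [Equiv.symm_apply_apply]
    exact List.mem_toFinset.mp hj
  · intro h
    exact ⟨_, List.mem_toFinset.mpr h, Equiv.apply_symm_apply _ _⟩

/-- `|weilIdx P₀ s| = |P₀|`. -/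
theorem card_weilIdx (P₀ : Finset ι) (s : Bool) : (weilIdx P₀ s).card = P₀.card := by
  unfold weilIdx
  rw [Finset.card_image_of_injective _ (genEnum ι).injective,
    List.toFinset_card_of_nodup (nodup_weilList _ _), length_weilList]

/-- The sorted generator list of `weilIdx P₀ s` is a permutation of p5's `weilList P₀ s`. -/
theorem sortedList_weilIdx_perm (P₀ : Finset ι) (s : Bool) :
    (sortedList ι (weilIdx P₀ s)).Perm (weilList P₀ s) := by
  apply List.perm_of_nodup_nodup_toFinset_eq (nodup_sortedList ι _) (nodup_weilList _ _)
  ext j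
  rw [List.mem_toFinset, List.mem_toFinset, mem_sortedList, mem_weilIdx, Equiv.symm_apply_apply]

/-- The basis monomial of `weilIdx P₀ s` is `± w_{(P₀, s)}`. -/
theorem monoBasis_weilIdx (P₀ : Finset ι) (s : Bool) :
    ∃ ε : ℂ, (ε = 1 ∨ ε = -1) ∧ monoBasis ι (weilIdx P₀ s) = ε • weil P₀ s := by
  rw [monoBasis_apply]
  exact WeilVector.mono_perm (sortedList_weilIdx_perm P₀ s)

/-- The generator set of the sorted list of `t`, pulled back to the enumeration, is `t`. -/
theorem toFinset_sortedList_eq_iff (t t' : Finset (Fin (Fintype.card (Gen ι)))) :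
    (sortedList ι t).toFinset = (sortedList ι t').toFinset ↔ t = t' := by
  constructor
  · intro h
    ext k
    have := congrArg (fun S => (genEnum ι).symm k ∈ S) h
    simp only [List.mem_toFinset, mem_sortedList, Equiv.apply_symm_apply, eq_iff_iff] at this
    exact this
  · rintro rfl; rfl

/-- A basis monomial other than `e_{weilIdx P₀ σ̄}` pairs to zero with `E_{I_σ} ∧ w_σ`
(p5's Lemma A5.6, monomial form, plus the degree count). -/
theorem integral_monoBasis_mul_ET_mul_weil_eq_zero (P₀ : Finset ι) (s : Bool) (hP₀ : P₀.card = 4)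
    (t : Finset (Fin (Fintype.card (Gen ι)))) (ht : t ≠ weilIdx P₀ !s) :
    integral (monoBasis ι t * ET (Finset.univ \ P₀) * weil P₀ s) = 0 := by
  rw [monoBasis_apply]
  by_cases hcard : t.card = 4
  · apply integral_mono_mul_ET_mul_weil_eq_zero P₀ s (nodup_sortedList ι t)
    · unfold sortedList
      rw [List.length_ofFn, hcard, hP₀]
    · intro h
      apply ht
      rw [← toFinset_sortedList_eq_iff]
      rw [h]
      exact (List.toFinset_eq_of_perm _ _ (sortedList_weilIdx_perm P₀ !s)).symm
  · rw [mul_assoc, ET_mul_weil_eq_mono, ← mono_append]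
    apply integral_mono_eq_zero_of_length_ne
    intro h
    apply hcard
    have hN : Fintype.card (Gen ι) = 2 * Fintype.card ι := by
      simp [Gen, Fintype.card_prod, mul_comm]
    have h4 : 4 ≤ Fintype.card ι := hP₀ ▸ Finset.card_le_univ P₀
    rw [List.length_append, List.length_append, length_planeList, length_weilList,
      Finset.card_sdiff_of_subset (Finset.subset_univ _), Finset.card_univ, hP₀, hN] at h
    have hlen : (sortedList ι t).length = t.card := by
      unfold sortedList; rw [List.length_ofFn]
    rw [hlen] at h
    omega

/-! ## 3. Detection: the integral of `x ∧ E_{I_σ} ∧ w_σ` is the `w_σ̄`-coordinate of `x` -/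

/-- **Lemma A5.6, basis form:** `∫ (x ∧ E_{I_σ} ∧ w_σ) = ± vol · (coordinate of x at the Weil
monomial w_σ̄)` for EVERY element `x` of the model. -/
theorem integral_mul_ET_mul_weil (P₀ : Finset ι) (s : Bool) (hP₀ : P₀.card = 4) (x : A ι) :
    ∃ ε : ℂ, (ε = 1 ∨ ε = -1) ∧
      integral (x * ET (Finset.univ \ P₀) * weil P₀ s) =
        ε * vol ι * (monoBasis ι).repr x (weilIdx P₀ !s) := by
  obtain ⟨ε, hε, hw⟩ := monoBasis_weilIdx P₀ (!s)
  refine ⟨ε, hε, ?_⟩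
  conv_lhs => rw [← (monoBasis ι).sum_repr x]
  rw [Finset.sum_mul, Finset.sum_mul, map_sum]
  rw [Finset.sum_eq_single (weilIdx P₀ !s)]
  · rw [smul_mul_assoc, smul_mul_assoc, map_smul, hw, smul_mul_assoc, smul_mul_assoc, map_smul,
      integral_weil_conj_mul_ET_mul_weil P₀ s hP₀, smul_eq_mul, smul_eq_mul]
    ring
  · intro t _ ht
    rw [smul_mul_assoc, smul_mul_assoc, map_smul,
      integral_monoBasis_mul_ET_mul_weil_eq_zero P₀ s hP₀ t ht, smul_zero]
  · intro h
    exact absurd (Finset.mem_univ _) h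

/-- **Lemma A5.6 with `θ⁸`:** `∫ (x ∧ θ^{|I_σ|} ∧ w_σ) = |I_σ|!·c_{I_σ}·(± vol)·(coordinate of x at w_σ̄)`. -/
theorem integral_mul_theta_pow_mul_weil (c : ι → ℂ) (P₀ : Finset ι) (s : Bool) (hP₀ : P₀.card = 4)
    (x : A ι) :
    ∃ ε : ℂ, (ε = 1 ∨ ε = -1) ∧
      integral (x * (theta c ^ (Finset.univ \ P₀).card * weil P₀ s)) =
        (((Finset.univ \ P₀).card.factorial : ℂ) * ∏ p ∈ Finset.univ \ P₀, c p) *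
          (ε * vol ι * (monoBasis ι).repr x (weilIdx P₀ !s)) := by
  obtain ⟨ε, hε, h⟩ := integral_mul_ET_mul_weil P₀ s hP₀ x
  refine ⟨ε, hε, ?_⟩
  have hE : ∀ p ∈ P₀, E p * weil P₀ s = 0 := fun p hp => by
    unfold weil
    exact E_mul_mono_of_mem (List.mem_map.mpr ⟨p, Finset.mem_toList.mpr hp, rfl⟩)
  rw [theta_pow_card_mul c P₀ _ hE, mul_smul_comm, map_smul, smul_eq_mul, ← mul_assoc, h]

/-! ## 4. The model Weil projector -/

/-- The projector of the model onto the monomials indexed by a finite set `W` of index sets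
(the coordinates at `W` are kept, all others are killed); with `W` = the six Weil index sets it is
the prose's `p_W ⊗ 1 = Σ_τ λ_τ(·) w_τ` (Prop. A2.3(i)). -/
noncomputable def modelWeilProj (W : Finset (Finset (Fin (Fintype.card (Gen ι))))) : A ι →ₗ[ℂ] A ι :=
  ∑ t ∈ W, ((monoBasis ι).coord t).smulRight (monoBasis ι t)

omit [DecidableEq ι] in
/-- `modelWeilProj W x = Σ_{t ∈ W} (repr x t) • e_t`. -/
theorem weilProj_apply (W : Finset (Finset (Fin (Fintype.card (Gen ι))))) (x : A ι) :
    modelWeilProj W x = ∑ t ∈ W, (monoBasis ι).repr x t • monoBasis ι t := by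
  unfold modelWeilProj
  rw [LinearMap.sum_apply]
  rfl

omit [DecidableEq ι] in
/-- The coordinates of `modelWeilProj W x`: those of `x` on `W`, zero elsewhere. -/
theorem repr_weilProj (W : Finset (Finset (Fin (Fintype.card (Gen ι))))) (x : A ι)
    (t : Finset (Fin (Fintype.card (Gen ι)))) :
    (monoBasis ι).repr (modelWeilProj W x) t = if t ∈ W then (monoBasis ι).repr x t else 0 := by
  rw [weilProj_apply, map_sum, Finsupp.finsetSum_apply]
  simp only [map_smul, Module.Basis.repr_self, Finsupp.smul_single, smul_eq_mul, mul_one,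
    Finsupp.single_apply]
  rw [Finset.sum_ite_eq']

omit [DecidableEq ι] in
/-- If the Weil projection of `x` vanishes, every Weil coordinate of `x` vanishes. -/
theorem repr_eq_zero_of_weilProj_eq_zero (W : Finset (Finset (Fin (Fintype.card (Gen ι)))))
    (x : A ι) (h : modelWeilProj W x = 0) {t : Finset (Fin (Fintype.card (Gen ι)))} (ht : t ∈ W) :
    (monoBasis ι).repr x t = 0 := by
  have := repr_weilProj W x t
  rw [h, map_zero, Finsupp.zero_apply, if_pos ht] at this
  exact this.symm

end Summit.Ventures.HodgeRepro2.T6.A3Detect
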